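import Literature.NumberTheory.EllipticCurves.ZpExtensionGaloisTwistLocalKummer
import Literature.NumberTheory.EllipticCurves.ZpExtensionGaloisTwistSelmerStructure
import Literature.NumberTheory.EllipticCurves.Sprung2012.SharpFlatSelmer
import HarnessLib

/-!
# The ♯/♭-TWISTED Selmer structures on `E[p^J](χ_u)` over a number field: Sprung's annihilator condition
# `E^•_{∞,𝔭} = Ann(Ker Col^•)` (Def. 7.9) read on `H¹(Γ_{K_v}, E[p^J](χ_u))`, the structure it cuts out of the
# twisted Kummer structure `𝓕`, the STRICT-at-`p` structure, and the inclusions `strict ≤ ♭ ≤ 𝓕 ≤ 𝓖`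
# (definitions with bodies + unfolding lemmas + the bridge to `sharpFlatLocalKummerOverOfEmb`)

Topic `NumberTheory/EllipticCurves` (next to its siblings `ZpExtensionGaloisTwistSelmerStructure` — the pair
`𝓕 = W.twistedKummerSelmerStructure ≤ 𝓖 = W.twistedRelaxedSelmerStructure` with the FULL Kummer condition at
`v ∣ p` — and `ZpExtensionGaloisTwistSignedSelmerStructure` — Kobayashi's `±` conditions cut out by subgroups of
points `A_v`); namespace `WeierstrassCurve`. DEFINITIONS WITH BODIES + theorems; no named fact, no instance, no
notation.

Sprung (J. Number Theory 132 (2012), Def. 7.9, p. 1503): «We let `E^♯_{∞,𝔭}` (resp. `E^♭_{∞,𝔭}`) be the exact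
annihilator of `Ker Col^♯` (resp. `Ker Col^♭`) under the local Tate pairing»; Def. 7.11: «`Sel^♭(E/K_∞) :=
Ker( Sel(E/K_∞) → E(K_{∞,𝔭}) ⊗ ℚ_p/ℤ_p / E^♭_{∞,𝔭} )`». In the tree this is the condition
`Sprung2012.sharpFlatLocalKummerOverOfEmb W p H ι M 𝒦` on GLOBAL classes over `K_∞` (`H = ker κ`): the class
restricted to `Gal(K̄_v/(K_∞)_w)` is the Kummer cocycle `τ ↦ τQ − Q` of a point `Q` with `x = p^k Q ∈ M`
(`M = E((K_∞)_w)`, `localTowerPointsOfEmb`) AND `p^k ∣ z(x)` for every functional `z ∈ 𝒦` (`𝒦 = Ker Col^•`,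
`colemanKer`); `Sel^•(E/K_∞) = sharpFlatSelmerInfty W κ ι ap g c •`. Greenberg's twisted descent at finite level
(LNM 1716 §4 pp. 122–124, modules `A_s[p^J] = E[p^J](χ_u) = W.twistedTorsionGaloisModule p κ J u hu`) is a
Poitou–Tate argument over the number field `K`, whose Selmer structures are families of LOCAL conditions
`𝓛_v ≤ H¹(Γ_{K_v}, E[p^J](χ_u))` (`DiscreteGaloisModule.SelmerStructure`). This file supplies the •-condition at
that level and the Selmer structures built from it (cell `bsd-2adic`, seat `t42`; consumer: the `ψ₂`-twisted descent
`u = −1`, `p = 2` into Sprung's `Sel♭(E/ℚ_∞)[γ+1]` for the supersingular line `odd_blind_package` of crux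
`SupersingularRankZeroAtTwo`, HOME/ss/gen18/CDF-ATTACK-GEN18.md §6):

* `W.twistedSharpFlatLocalKummer p κ J u hu E M 𝒦 ≤ H¹(Γ_E, E[p^J](χ_u)|_{Γ_E})` (`E` a completion of `K`,
  `M ≤ E(K̄_E)`, `𝒦 ⊆ Hom(M, ℤ_p)`): the classes `y = [ψ]` with `pointsMap (ψ τ) = τ•Q − Q` on
  `Gal(K̄_E/(K_∞)_w)` for a point `Q` with `p^k Q ∈ M` and `p^k ∣ z(p^k Q)` for all `z ∈ 𝒦` — the sibling
  `W.twistedTorsionLocalKummer p κ J u hu E M` (`ZpExtensionGaloisTwistLocalKummer`) with Sprung's divisibility clause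
  added; unfolding, antitone in `𝒦`, `≤ twistedTorsionLocalKummer … M ≤ ker twistedTorsionToLocalH1`;
* **the bridge** `twistedTorsionToH1_mem_sharpFlatLocalKummerOverOfEmb_iff`: for a GLOBAL class
  `x ∈ H¹(Γ_K, E[p^J](χ_u))`, `twistedTorsionToH1 x ∈ sharpFlatLocalKummerOverOfEmb W p (ker κ) (closureEmb E) M 𝒦`
  iff `res_E x ∈ twistedSharpFlatLocalKummer … E M 𝒦` (same point up to a torsion point absorbed into `(Q, k)`,
  word for word the sibling bridge `twistedTorsionToH1_mem_localKummerOverOfEmb_iff`), and its corollary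
  `twistedTorsionToH1_mem_sharpFlatSelmerInfty`: a class whose image lies in `Sel_{p^∞}(E/K_∞)` and whose
  localisation at `v` satisfies the •-condition for `(E((K_∞)_w), Ker Col^•)` maps INTO `Sel^•(E/K_∞)` (all
  conjugate places by `conjH1_twistedTorsionToH1_mem`);
* `W.twistedSelmerStructureOfLocal p S₀ κ J u hu L`: the twisted Kummer structure `𝓕` with an ARBITRARY family
  `L = (L_v)_v` of local conditions at the places `v ∋ p`, `v ∉ S₀` (Kummer kernel at `∞`, everything at `S₀`,
  unramified elsewhere); `L ↦ 𝓕^L` is monotone, `𝓕^{ker} = 𝓕` (`twistedSelmerStructureOfLocal_ker`), `𝓕^L ≤ 𝓖`;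
* `W.twistedStrictSelmerStructure p S₀ κ J u hu = 𝓕^0` (locally trivial at `v ∋ p`: Greenberg's `L_v = 0`, the
  strict Selmer group) and `W.twistedSharpFlatSelmerStructure p S₀ κ J u hu v M 𝒦 = 𝓕^{L♭}`, `L♭ =` the Kummer
  kernels updated at ONE distinguished place `v ∋ p` by `twistedSharpFlatLocalKummer … (v.adicCompletion K) M 𝒦`
  (Sprung: ONE place of `K_∞` above `p`; TODO(general form): several places above `p`, a family `(M_v, 𝒦_v)_v`);
* the inclusions `strict ≤ ♭ ≤ 𝓕 ≤ 𝓖` (`𝓖 = W.twistedRelaxedSelmerStructure` BY NAME), `IsUnramifiedOutside` for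
  all of them, and what membership in `H¹_{𝓕^L}` says place by place.

Not here (Summits-side theorems, seat `t42` BRICK 1): `H¹_𝓕(K, E[p^J](χ_u)) → Sel_{p^∞}(E/K_∞)` (unramified ⇒
Kummer at `v ∤ p` along the cyclotomic tower), the `[γ+1]`-part at `u = −1`, injectivity. Nothing is asserted
about any curve; BSD is not proved by any of this.

References: F. Sprung, J. Number Theory 132 (2012), Def. 7.9, Def. 7.11 (p. 1503) [Sprung2012]; R. Greenberg,
LNM 1716 (1999), §4 pp. 122–124 [GreenbergLNM1716]; S. Kobayashi, Invent. math. 152 (2003), Def. 1.1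
[Kobayashi2003]; B. Howard, Compositio Math. 140 (2004), Def. 2.1.10 [Howard2004HeegnerKolyvagin].
-/

noncomputable section

open scoped Classical

open CategoryTheory NumberField IsDedekindDomain Field
open Literature.NumberTheory.EllipticCurves Literature.NumberTheory.GaloisRepresentations
  Literature.NumberTheory.GaloisCohomology Literature.NumberTheory.EllipticCurves.Kobayashi2003
  Literature.NumberTheory.EllipticCurves.Sprung2012 Literature.NumberTheory.EllipticCurves.Sprung2017
open Literature.NumberTheory.GaloisRepresentations.DiscreteGaloisModule (unramifiedSubgroup SelmerStructure)
open scoped ContRepresentation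

universe u

namespace WeierstrassCurve

/-! ## The •-condition `Ann(𝒦)` on `H¹(Γ_E, E[p^J](χ_u))` at a completion `E` -/

section Local

variable {K : Type u} [Field K] (W : WeierstrassCurve K) (p : ℕ) [Fact p.Prime]
  (κ : ZpExtension K p) (J : ℕ) (u : ℤ) (hu : (p : ℤ) ∣ u - 1)
  (E : Type u) [Field E] [Algebra K E]

/-- **Sprung's annihilator condition `E^•_{∞,𝔭} = Ann(Ker Col^•)` (Def. 7.9) on `H¹(Γ_E, E[p^J](χ_u))`**: for a
subgroup `M ⊆ E(K̄_E)` (meant: `E((K_∞)_w) = localTowerPointsOfEmb κ (closureEmb E) W`) and a set `𝒦` of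
functionals `M →+ ℤ_p` (meant: `Ker Col^• = colemanKer …`), the classes `y = [ψ]` such that on
`Gal(K̄_E/(K_∞)_w)` (`localSubgroup (ker κ) E`, where `χ_u` is trivial) `pointsMap (ψ τ) = τ•Q − Q` for a point
`Q ∈ E(K̄_E)` with `x = p^k Q ∈ M` — the Kummer class of `x ⊗ p^{-k}` — AND `p^k ∣ z(x)` for every `z ∈ 𝒦` (the local
Tate pairing of `x ⊗ p^{-k}` with `z` is `z(x)/p^k mod ℤ_p`). The sibling `twistedTorsionLocalKummer … E M` with the
divisibility clause of `sharpFlatLocalKummerOverOfEmb` added; an additive subgroup (from `(Q₁, k₁)`, `(Q₂, k₂)` pass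
to `(Q₁ + Q₂, k₁ + k₂)`). [cite: Sprung2012, Def. 7.9 and Def. 7.11 (p. 1503)] [cite: GreenbergLNM1716, §4 p. 124] -/
def twistedSharpFlatLocalKummer (M : AddSubgroup (localPoints W E)) (𝒦 : Set (M →+ ℤ_[p])) :
    AddSubgroup (galoisCohomology ((W.twistedTorsionGaloisModule p κ J u hu).restrictField E) 1) where
  carrier := {y | ∃ (ψ : contOneCocycles ((W.twistedTorsionGaloisModule p κ J u hu).restrictField E).toTopRep)
      (Q : localPoints W E) (k : ℕ) (hQ : p ^ k • Q ∈ M), oneCocycleClass _ ψ = y ∧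
      (∀ z ∈ 𝒦, (p : ℤ_[p]) ^ k ∣ z ⟨p ^ k • Q, hQ⟩) ∧
      ∀ τ : localSubgroup κ.kerSubgroup E,
        pointsMap W E ((ψ.1 (τ : absoluteGaloisGroup E) : W.geomTorsion ((p ^ J : ℕ) : ℤ)) : W.geomPoints) =
          (τ : absoluteGaloisGroup E) • Q - Q}
  zero_mem' := ⟨0, 0, 0, by rw [smul_zero]; exact zero_mem M, oneCocycleClass_zero _,
    fun z _ ↦ by rw [pow_zero]; exact one_dvd _,
    fun τ ↦ by rw [smul_zero, sub_zero]; exact map_zero _⟩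
  add_mem' := by
    rintro y₁ y₂ ⟨ψ₁, Q₁, k₁, hM₁, rfl, hK₁, h₁⟩ ⟨ψ₂, Q₂, k₂, hM₂, rfl, hK₂, h₂⟩
    have hM : p ^ (k₁ + k₂) • (Q₁ + Q₂) ∈ M := by
      rw [smul_add]
      refine add_mem ?_ ?_
      · rw [pow_add, mul_comm, mul_smul]; exact AddSubgroup.nsmul_mem M hM₁ _
      · rw [pow_add, mul_smul]; exact AddSubgroup.nsmul_mem M hM₂ _
    refine ⟨ψ₁ + ψ₂, Q₁ + Q₂, k₁ + k₂, hM, oneCocycleClass_add _ ψ₁ ψ₂, fun z hz ↦ ?_, fun τ ↦ ?_⟩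
    · have hx : (⟨p ^ (k₁ + k₂) • (Q₁ + Q₂), hM⟩ : M) =
          p ^ k₂ • (⟨p ^ k₁ • Q₁, hM₁⟩ : M) + p ^ k₁ • (⟨p ^ k₂ • Q₂, hM₂⟩ : M) := by
        apply Subtype.ext
        change p ^ (k₁ + k₂) • (Q₁ + Q₂) = p ^ k₂ • (p ^ k₁ • Q₁) + p ^ k₁ • (p ^ k₂ • Q₂)
        rw [smul_smul, smul_smul, ← pow_add, ← pow_add, add_comm k₂ k₁, smul_add]
      rw [hx, map_add, map_nsmul, map_nsmul, pow_add]
      refine dvd_add ?_ ?_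
      · rw [nsmul_eq_mul, Nat.cast_pow, mul_comm ((p : ℤ_[p]) ^ k₁)]
        exact mul_dvd_mul_left _ (hK₁ z hz)
      · rw [nsmul_eq_mul, Nat.cast_pow]
        exact mul_dvd_mul_left _ (hK₂ z hz)
    · rw [Submodule.coe_add, ContinuousMap.add_apply, AddSubgroup.coe_add, map_add, h₁ τ, h₂ τ, smul_add]
      abel
  neg_mem' := by
    rintro y ⟨ψ, Q, k, hM, rfl, hK, h⟩
    have hM' : p ^ k • (-Q) ∈ M := by rw [smul_neg]; exact neg_mem hM
    refine ⟨-ψ, -Q, k, hM', ?_, fun z hz ↦ ?_, fun τ ↦ ?_⟩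
    · change oneCocycleClassₗ _ (-ψ) = -oneCocycleClassₗ _ ψ
      exact map_neg _ ψ
    · have hx : (⟨p ^ k • (-Q), hM'⟩ : M) = -⟨p ^ k • Q, hM⟩ := Subtype.ext (smul_neg _ _)
      rw [hx, map_neg]
      exact (dvd_neg).2 (hK z hz)
    · rw [Submodule.coe_neg, ContinuousMap.neg_apply, AddSubgroup.coe_neg, map_neg, h τ, smul_neg]
      abel

variable {W p κ J u hu E}

/-- Membership in the •-condition (unfolding). [cite: Sprung2012, Def. 7.9 (p. 1503) (unfolding)] -/
theorem mem_twistedSharpFlatLocalKummer_iff (M : AddSubgroup (localPoints W E)) (𝒦 : Set (M →+ ℤ_[p]))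
    (y : galoisCohomology ((W.twistedTorsionGaloisModule p κ J u hu).restrictField E) 1) :
    y ∈ W.twistedSharpFlatLocalKummer p κ J u hu E M 𝒦 ↔
      ∃ (ψ : contOneCocycles ((W.twistedTorsionGaloisModule p κ J u hu).restrictField E).toTopRep)
        (Q : localPoints W E) (k : ℕ) (hQ : p ^ k • Q ∈ M), oneCocycleClass _ ψ = y ∧
        (∀ z ∈ 𝒦, (p : ℤ_[p]) ^ k ∣ z ⟨p ^ k • Q, hQ⟩) ∧
        ∀ τ : localSubgroup κ.kerSubgroup E,
          pointsMap W E ((ψ.1 (τ : absoluteGaloisGroup E) : W.geomTorsion ((p ^ J : ℕ) : ℤ)) : W.geomPoints) =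
            (τ : absoluteGaloisGroup E) • Q - Q :=
  Iff.rfl

/-- The •-condition is antitone in the set of functionals `𝒦`. [cite: Sprung2012, Def. 7.9 (p. 1503) (unfolding)] -/
theorem twistedSharpFlatLocalKummer_antitone (M : AddSubgroup (localPoints W E)) {𝒦 𝒦' : Set (M →+ ℤ_[p])}
    (h : 𝒦 ⊆ 𝒦') :
    W.twistedSharpFlatLocalKummer p κ J u hu E M 𝒦' ≤ W.twistedSharpFlatLocalKummer p κ J u hu E M 𝒦 := by
  rintro y ⟨ψ, Q, k, hM, hy, hK, hτ⟩
  exact ⟨ψ, Q, k, hM, hy, fun z hz ↦ hK z (h hz), hτ⟩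

/-- **The •-condition refines the Kummer condition cut out by `M`**: forgetting the divisibility clause, every class
of `twistedSharpFlatLocalKummer … E M 𝒦` lies in the sibling `twistedTorsionLocalKummer … E M` (so `Sel^• ⊆ Sel`).
[cite: Sprung2012, Def. 7.11 (p. 1503)] -/
theorem twistedSharpFlatLocalKummer_le_twistedTorsionLocalKummer (M : AddSubgroup (localPoints W E))
    (𝒦 : Set (M →+ ℤ_[p])) :
    W.twistedSharpFlatLocalKummer p κ J u hu E M 𝒦 ≤ W.twistedTorsionLocalKummer p κ J u hu E M := by
  rintro y ⟨ψ, Q, k, hM, hy, -, hτ⟩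
  exact ⟨ψ, Q, k, hy, hM, hτ⟩

/-- Hence every class of the •-condition dies in `H¹((K_∞)_w, E(K̄_E))`: it lies in the kernel of
`twistedTorsionToLocalH1` (the FULL Kummer condition at `v ∣ p` of `twistedKummerSelmerStructure`).
[cite: GreenbergLNM1716, §4 p. 124] -/
theorem twistedSharpFlatLocalKummer_le_ker (M : AddSubgroup (localPoints W E)) (𝒦 : Set (M →+ ℤ_[p])) :
    W.twistedSharpFlatLocalKummer p κ J u hu E M 𝒦 ≤ (W.twistedTorsionToLocalH1 p κ J u hu E).ker :=
  (twistedSharpFlatLocalKummer_le_twistedTorsionLocalKummer M 𝒦).trans (W.twistedTorsionLocalKummer_le_ker M)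

/-- For `𝒦 = ∅` (no functional) the •-condition is the Kummer condition cut out by `M`.
[cite: Sprung2012, Def. 7.9 (p. 1503) (unfolding)] -/
theorem twistedSharpFlatLocalKummer_empty (M : AddSubgroup (localPoints W E)) :
    W.twistedSharpFlatLocalKummer p κ J u hu E M ∅ = W.twistedTorsionLocalKummer p κ J u hu E M := by
  refine le_antisymm (twistedSharpFlatLocalKummer_le_twistedTorsionLocalKummer M ∅) ?_
  rintro y ⟨ψ, Q, k, hy, hM, hτ⟩
  exact ⟨ψ, Q, k, hM, hy, fun z hz ↦ (Set.notMem_empty z hz).elim, hτ⟩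

/-- Change of level: `H¹(ι|_{Γ_E})` maps the •-condition of level `j` into that of level `J ≥ j` (same `(Q, k)`;
`ι` is the identity on points). [cite: GreenbergLNM1716, §4 p. 124] -/
theorem map_incl_mem_twistedSharpFlatLocalKummer {j : ℕ} (hjJ : j ≤ J) (M : AddSubgroup (localPoints W E))
    (𝒦 : Set (M →+ ℤ_[p]))
    {y : galoisCohomology ((W.twistedTorsionGaloisModule p κ j u hu).restrictField E) 1}
    (hy : y ∈ W.twistedSharpFlatLocalKummer p κ j u hu E M 𝒦) :
    galoisCohomology.map ((W.twistedTorsionIncl p κ hjJ u hu).restrictField E) 1 y ∈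
      W.twistedSharpFlatLocalKummer p κ J u hu E M 𝒦 := by
  obtain ⟨ψ, Q, k, hM, rfl, hK, hτ⟩ := hy
  rw [galoisCohomology.map_one_oneCocycleClass]
  exact ⟨_, Q, k, hM, rfl, hK, fun τ ↦ hτ τ⟩

omit [Fact p.Prime] in
/-- A geometric `p`-power-torsion point is killed by some `p^n`. [folklore] -/
private theorem exists_pow_smul_eq_zero_geomPrimaryTorsion' (t : W.geomPrimaryTorsion p) :
    ∃ n : ℕ, p ^ n • t = 0 := by
  obtain ⟨n, hn⟩ := (AddCommGroup.mem_primaryComponent).mp t.2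
  exact ⟨n, Subtype.ext (by rw [AddSubgroupClass.coe_nsmul, hn, ZeroMemClass.coe_zero])⟩

/-- Divisibility bookkeeping: if `p^k ∣ a` then `p^(k+n) ∣ p^n • a` in `ℤ_p`. [folklore] -/
private theorem pow_add_dvd_nsmul {k n : ℕ} {a : ℤ_[p]} (h : (p : ℤ_[p]) ^ k ∣ a) :
    (p : ℤ_[p]) ^ (k + n) ∣ p ^ n • a := by
  rw [nsmul_eq_mul, Nat.cast_pow, pow_add, mul_comm ((p : ℤ_[p]) ^ k)]
  exact mul_dvd_mul_left _ h

/-- **The bridge to Sprung's condition on global classes (Def. 7.9 / 7.11).** For `x ∈ H¹(Γ_K, E[p^J](χ_u))`, a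
subgroup `M ⊆ E(K̄_E)` and functionals `𝒦 ⊆ Hom(M, ℤ_p)`: the image `twistedTorsionToH1 x ∈ H¹(K_∞, E[p^∞])` lies in
`sharpFlatLocalKummerOverOfEmb W p (ker κ) (closureEmb E) M 𝒦` iff the localisation `res_E x` lies in
`twistedSharpFlatLocalKummer … E M 𝒦`. Both sides say: on `Gal(K̄_E/(K_∞)_w)` a cocycle representative is
`τ ↦ τ•Q − Q` with `p^k Q ∈ M` and `p^k ∣ z(p^k Q)` (`z ∈ 𝒦`); a change of representative (the coboundary of a
torsion point `t`, `p^n t = 0`) is absorbed by `Q ↦ Q − t`, `k ↦ k + n`, under which `p^{k+n}(Q − t) = p^n · p^k Q` and the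
divisibility clause persists (`p^{k+n} ∣ p^n z(p^k Q)`). Word for word the sibling
`twistedTorsionToH1_mem_localKummerOverOfEmb_iff`. [cite: Sprung2012, Def. 7.9 and Def. 7.11 (p. 1503)]
[cite: GreenbergLNM1716, §4 p. 124] -/
theorem twistedTorsionToH1_mem_sharpFlatLocalKummerOverOfEmb_iff (M : AddSubgroup (localPoints W E))
    (𝒦 : Set (M →+ ℤ_[p])) (x : galoisCohomology (W.twistedTorsionGaloisModule p κ J u hu) 1) :
    W.twistedTorsionToH1 p κ J u hu x ∈
        sharpFlatLocalKummerOverOfEmb W p κ.kerSubgroup (closureEmb (K := K) E) M 𝒦 ↔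
      galoisCohomology.res (W.twistedTorsionGaloisModule p κ J u hu) E 1 x ∈
        W.twistedSharpFlatLocalKummer p κ J u hu E M 𝒦 := by
  obtain ⟨ξ, rfl⟩ := oneCocycleClass_surjective _ x
  rw [twistedTorsionToH1_oneCocycleClass, galoisCohomology.res_oneCocycleClass,
    mem_sharpFlatLocalKummerOverOfEmb_iff, mem_twistedSharpFlatLocalKummer_iff]
  constructor
  · rintro ⟨φ, Q, k, hM, hφ, hK, hτ⟩
    -- `φ` and the pushed restriction of `ξ` differ by the coboundary of a torsion point `t`
    rw [← sub_eq_zero, ← oneCocycleClass_sub, oneCocycleClass_eq_zero_iff] at hφ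
    obtain ⟨t, ht⟩ := hφ
    obtain ⟨n, hn⟩ := W.exists_pow_smul_eq_zero_geomPrimaryTorsion' (p := p) t
    have ht0 : p ^ (k + n) • pointsMap W E (t : W.geomPoints) = 0 := by
      rw [pow_add, mul_smul, ← map_nsmul, ← AddSubgroupClass.coe_nsmul, hn, ZeroMemClass.coe_zero, map_zero,
        smul_zero]
    have hM' : p ^ (k + n) • (Q - pointsMap W E (t : W.geomPoints)) ∈ M := by
      rw [smul_sub, ht0, sub_zero, pow_add, mul_comm, mul_smul]
      exact AddSubgroup.nsmul_mem M hM _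
    have hx : (⟨p ^ (k + n) • (Q - pointsMap W E (t : W.geomPoints)), hM'⟩ : M) =
        p ^ n • (⟨p ^ k • Q, hM⟩ : M) := by
      apply Subtype.ext
      change p ^ (k + n) • (Q - pointsMap W E (t : W.geomPoints)) = p ^ n • (p ^ k • Q)
      rw [smul_sub, ht0, sub_zero, pow_add, mul_comm, mul_smul]
    refine ⟨_, Q - pointsMap W E (t : W.geomPoints), k + n, hM', rfl, fun z hz ↦ ?_, fun τ ↦ ?_⟩
    · rw [hx, map_nsmul]
      exact pow_add_dvd_nsmul (hK z hz)
    · -- the values on the local subgroup, read in `E(K̄_E)`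
      have e1 : pointsMap W E ((φ.1 (resGalSubgroupOfEmb κ.kerSubgroup (closureEmb (K := K) E) τ) :
            W.geomPrimaryTorsion p) : W.geomPoints) -
          pointsMap W E ((ξ.1 (resGal (K := K) E (τ : absoluteGaloisGroup E)) :
            W.geomTorsion ((p ^ J : ℕ) : ℤ)) : W.geomPoints) =
          (τ : absoluteGaloisGroup E) • pointsMap W E (t : W.geomPoints) - pointsMap W E (t : W.geomPoints) := by
        have h := congrArg (fun z : W.geomPrimaryTorsion p ↦ pointsMap W E (z : W.geomPoints))
          (ht (resGalSubgroupOfEmb κ.kerSubgroup (closureEmb (K := K) E) τ))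
        simp only [ContinuousMap.sub_apply, AddSubgroupClass.coe_sub, map_sub] at h
        rw [← pointsMap_smul]
        exact h
      have e2 : pointsMap W E ((φ.1 (resGalSubgroupOfEmb κ.kerSubgroup (closureEmb (K := K) E) τ) :
          W.geomPrimaryTorsion p) : W.geomPoints) = (τ : absoluteGaloisGroup E) • Q - Q := hτ τ
      change pointsMap W E ((ξ.1 (resGal (K := K) E (τ : absoluteGaloisGroup E)) :
          W.geomTorsion ((p ^ J : ℕ) : ℤ)) : W.geomPoints) = _
      rw [sub_eq_iff_eq_add] at e1
      rw [e1] at e2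
      calc pointsMap W E ((ξ.1 (resGal (K := K) E (τ : absoluteGaloisGroup E)) :
              W.geomTorsion ((p ^ J : ℕ) : ℤ)) : W.geomPoints)
          = ((τ : absoluteGaloisGroup E) • Q - Q) -
              ((τ : absoluteGaloisGroup E) • pointsMap W E (t : W.geomPoints) - pointsMap W E (t : W.geomPoints)) := by
            rw [← e2]; abel
        _ = _ := by rw [smul_sub]; abel
  · rintro ⟨ψ, Q, k, hM, hψ, hK, hτ⟩
    -- `ψ` and the restriction of `ξ` differ by the coboundary of a point `m ∈ E[p^J]`
    rw [← sub_eq_zero, ← oneCocycleClass_sub, oneCocycleClass_eq_zero_iff] at hψ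
    obtain ⟨m, hm⟩ := hψ
    have hm0 : p ^ (k + J) • pointsMap W E (m : W.geomPoints) = 0 := by
      rw [pow_add, mul_smul, ← map_nsmul, ← AddSubgroupClass.coe_nsmul, W.pow_nsmul_geomTorsion_pow p J m,
        ZeroMemClass.coe_zero, map_zero, smul_zero]
    have hM' : p ^ (k + J) • (Q - pointsMap W E (m : W.geomPoints)) ∈ M := by
      rw [smul_sub, hm0, sub_zero, pow_add, mul_comm, mul_smul]
      exact AddSubgroup.nsmul_mem M hM _
    have hx : (⟨p ^ (k + J) • (Q - pointsMap W E (m : W.geomPoints)), hM'⟩ : M) =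
        p ^ J • (⟨p ^ k • Q, hM⟩ : M) := by
      apply Subtype.ext
      change p ^ (k + J) • (Q - pointsMap W E (m : W.geomPoints)) = p ^ J • (p ^ k • Q)
      rw [smul_sub, hm0, sub_zero, pow_add, mul_comm, mul_smul]
    refine ⟨_, Q - pointsMap W E (m : W.geomPoints), k + J, hM', rfl, fun z hz ↦ ?_, fun τ ↦ ?_⟩
    · rw [hx, map_nsmul]
      exact pow_add_dvd_nsmul (hK z hz)
    · have hτker : resGal (K := K) E (τ : absoluteGaloisGroup E) ∈ κ.kerSubgroup :=
        (mem_localSubgroup_iff κ.kerSubgroup E _).mp τ.2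
      -- the twisted action of `τ` on `m` is the plain Galois action (`τ|_{K̄} ∈ ker κ`)
      have hact : ((((W.twistedTorsionGaloisModule p κ J u hu).restrictField E).toTopRep.ρ
            (τ : absoluteGaloisGroup E) m : W.geomTorsion ((p ^ J : ℕ) : ℤ)) : W.geomPoints) =
          resGal (K := K) E (τ : absoluteGaloisGroup E) • (m : W.geomPoints) := by
        change ((W.twistedTorsionGaloisModule p κ J u hu (resGal (K := K) E (τ : absoluteGaloisGroup E)) m :
            W.geomTorsion ((p ^ J : ℕ) : ℤ)) : W.geomPoints) = _
        rw [ZpExtension.galoisTwist_apply_of_mem_kerSubgroup _ _ _ _ _ _ hτker, torsionGaloisModule_apply_apply,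
          Literature.NumberTheory.EllipticCurves.AddSubgroup.torsionBy.coe_smul]
      have e1 : pointsMap W E ((ψ.1 (τ : absoluteGaloisGroup E) : W.geomTorsion ((p ^ J : ℕ) : ℤ)) : W.geomPoints) -
          pointsMap W E ((ξ.1 (resGal (K := K) E (τ : absoluteGaloisGroup E)) :
            W.geomTorsion ((p ^ J : ℕ) : ℤ)) : W.geomPoints) =
          (τ : absoluteGaloisGroup E) • pointsMap W E (m : W.geomPoints) - pointsMap W E (m : W.geomPoints) := by
        have h := congrArg (fun z : W.geomTorsion ((p ^ J : ℕ) : ℤ) ↦ pointsMap W E (z : W.geomPoints))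
          (hm (τ : absoluteGaloisGroup E))
        simp only [ContinuousMap.sub_apply, AddSubgroupClass.coe_sub, map_sub] at h
        rw [hact, pointsMap_smul] at h
        exact h
      have e2 : pointsMap W E ((ψ.1 (τ : absoluteGaloisGroup E) : W.geomTorsion ((p ^ J : ℕ) : ℤ)) :
          W.geomPoints) = (τ : absoluteGaloisGroup E) • Q - Q := hτ τ
      rw [sub_eq_iff_eq_add] at e1
      rw [e1] at e2
      change pointsMap W E ((ξ.1 (resGal (K := K) E (τ : absoluteGaloisGroup E)) :
          W.geomTorsion ((p ^ J : ℕ) : ℤ)) : W.geomPoints) = _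
      calc pointsMap W E ((ξ.1 (resGal (K := K) E (τ : absoluteGaloisGroup E)) :
              W.geomTorsion ((p ^ J : ℕ) : ℤ)) : W.geomPoints)
          = ((τ : absoluteGaloisGroup E) • Q - Q) -
              ((τ : absoluteGaloisGroup E) • pointsMap W E (m : W.geomPoints) - pointsMap W E (m : W.geomPoints)) := by
            rw [← e2]; abel
        _ = _ := by rw [smul_sub]; abel

end Local

/-! ## Into Sprung's `Sel^•(E/K_∞)` -/

section SharpFlatSelmer

variable {K : Type u} [Field K] [NumberField K] (W : WeierstrassCurve K) (p : ℕ) [Fact p.Prime]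
  (κ : ZpExtension K p) (J : ℕ) (u : ℤ) (hu : (p : ℤ) ∣ u - 1)
  {E : Type u} [Field E] [Algebra K E]

/-- **A twisted class whose image lies in `Sel_{p^∞}(E/K_∞)` and whose localisation at the completion `E`
satisfies the •-condition for `(E((K_∞)_w), Ker Col^•)` maps INTO Sprung's `Sel^•(E/K_∞)`** (Def. 7.11,
`sharpFlatSelmerInfty W κ (closureEmb E) ap g c •`): the •-condition at the chosen place is the bridge
`twistedTorsionToH1_mem_sharpFlatLocalKummerOverOfEmb_iff`; at the conjugate places `conj_σ`, `σ ∈ Γ_K`, it holds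
because the image is an eigenclass of every `conj_σ` (`conjH1_twistedTorsionToH1_mem`).
[cite: Sprung2012, Def. 7.11 (p. 1503)] [cite: GreenbergLNM1716, §4 pp. 107, 124] -/
theorem twistedTorsionToH1_mem_sharpFlatSelmerInfty (ap : ℤ) (g : absoluteGaloisGroup E)
    (c : ℕ → localPoints W E) (col : Chroma)
    (x : galoisCohomology (W.twistedTorsionGaloisModule p κ J u hu) 1)
    (hsel : W.twistedTorsionToH1 p κ J u hu x ∈ W.selmerInfty κ)
    (hloc : galoisCohomology.res (W.twistedTorsionGaloisModule p κ J u hu) E 1 x ∈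
      W.twistedSharpFlatLocalKummer p κ J u hu E (localTowerPointsOfEmb κ (closureEmb (K := K) E) W)
        (colemanKer κ (closureEmb (K := K) E) W ap g c col)) :
    W.twistedTorsionToH1 p κ J u hu x ∈ sharpFlatSelmerInfty W κ (closureEmb (K := K) E) ap g c col := by
  rw [mem_sharpFlatSelmerInfty_iff]
  refine ⟨hsel, fun σ ↦ W.conjH1_twistedTorsionToH1_mem p κ J u hu _ x ?_ σ⟩
  exact (twistedTorsionToH1_mem_sharpFlatLocalKummerOverOfEmb_iff _ _ x).2 hloc

end SharpFlatSelmer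

/-! ## The Selmer structures: an arbitrary family of conditions at `p`, the strict one, the ♯/♭ one -/

section Structures

variable {K : Type u} [Field K] [NumberField K] (W : WeierstrassCurve K) (p : ℕ) [Fact p.Prime]
  (S₀ : Finset (HeightOneSpectrum (𝓞 K))) (κ : ZpExtension K p) (J : ℕ) (u : ℤ) (hu : (p : ℤ) ∣ u - 1)
  (L : ∀ v : HeightOneSpectrum (𝓞 K),
    AddSubgroup (galoisCohomology ((W.twistedTorsionGaloisModule p κ J u hu).restrictField (v.adicCompletion K)) 1))

/-- **`𝓕^L`, the twisted Kummer structure with an ARBITRARY family `L = (L_v)_v` of local conditions at the places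
above `p`** on `M_J = E[p^J](χ_u)`: at an infinite place `w` the Kummer kernel (of
`twistedTorsionToLocalH1 … w.Completion`, as in `twistedKummerSelmerStructure`); at `v ∈ S₀` everything; at
`v ∋ p`, `v ∉ S₀`, the condition `L_v`; unramified classes at every other finite place. Greenberg's Selmer group
with local conditions `L_v` at `v ∣ p` (§4 p. 123 «changing `L_{v₀}` to `L'_{v₀}`»), finite-level twisted form.
[cite: GreenbergLNM1716, §4 pp. 122–124] [cite: Howard2004HeegnerKolyvagin, Def. 2.1.10] -/
def twistedSelmerStructureOfLocal : SelmerStructure (W.twistedTorsionGaloisModule p κ J u hu) := fun v =>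
  match v with
  | Sum.inl w => (W.twistedTorsionToLocalH1 p κ J u hu w.Completion).ker
  | Sum.inr v =>
      if v ∈ S₀ then ⊤
      else if ((p : ℕ) : 𝓞 K) ∈ v.asIdeal then L v
      else unramifiedSubgroup (GaloisRep.toLocal v (W.twistedTorsionGaloisModule p κ J u hu)) 1

/-- `𝓕^L` at an infinite place: the Kummer kernel. [cite: GreenbergLNM1716, §4 p. 123] -/
@[simp] theorem twistedSelmerStructureOfLocal_inl (w : InfinitePlace K) :
    W.twistedSelmerStructureOfLocal p S₀ κ J u hu L (Sum.inl w) =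
      (W.twistedTorsionToLocalH1 p κ J u hu w.Completion).ker := rfl

/-- `𝓕^L` at `v ∈ S₀`: no condition. [cite: GreenbergLNM1716, §4 p. 123] -/
theorem twistedSelmerStructureOfLocal_inr_of_mem {v : HeightOneSpectrum (𝓞 K)} (hv : v ∈ S₀) :
    W.twistedSelmerStructureOfLocal p S₀ κ J u hu L (Sum.inr v) = ⊤ := by
  change (if v ∈ S₀ then ⊤ else _) = _
  rw [if_pos hv]

/-- `𝓕^L` at `v ∋ p`, `v ∉ S₀`: the prescribed condition `L_v`. [cite: GreenbergLNM1716, §4 p. 123] -/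
theorem twistedSelmerStructureOfLocal_inr_of_mem_asIdeal {v : HeightOneSpectrum (𝓞 K)} (hv : v ∉ S₀)
    (hpv : ((p : ℕ) : 𝓞 K) ∈ v.asIdeal) :
    W.twistedSelmerStructureOfLocal p S₀ κ J u hu L (Sum.inr v) = L v := by
  change (if v ∈ S₀ then ⊤ else if ((p : ℕ) : 𝓞 K) ∈ v.asIdeal then _ else _) = _
  rw [if_neg hv, if_pos hpv]

/-- `𝓕^L` at a finite `v ∉ S₀` prime to `p`: unramified classes. [cite: Howard2004HeegnerKolyvagin, Def. 2.1.10] -/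
theorem twistedSelmerStructureOfLocal_inr_of_not_mem {v : HeightOneSpectrum (𝓞 K)} (hv : v ∉ S₀)
    (hpv : ((p : ℕ) : 𝓞 K) ∉ v.asIdeal) :
    W.twistedSelmerStructureOfLocal p S₀ κ J u hu L (Sum.inr v) =
      unramifiedSubgroup (GaloisRep.toLocal v (W.twistedTorsionGaloisModule p κ J u hu)) 1 := by
  change (if v ∈ S₀ then ⊤ else if ((p : ℕ) : 𝓞 K) ∈ v.asIdeal then _ else _) = _
  rw [if_neg hv, if_neg hpv]

/-- **`L ↦ 𝓕^L` is monotone** (place by place). [cite: GreenbergLNM1716, §4 p. 123] -/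
theorem twistedSelmerStructureOfLocal_mono
    {L L' : ∀ v : HeightOneSpectrum (𝓞 K),
      AddSubgroup (galoisCohomology ((W.twistedTorsionGaloisModule p κ J u hu).restrictField (v.adicCompletion K)) 1)}
    (h : ∀ v, L v ≤ L' v) :
    W.twistedSelmerStructureOfLocal p S₀ κ J u hu L ≤ W.twistedSelmerStructureOfLocal p S₀ κ J u hu L' := by
  intro v
  rcases v with w | v
  · exact le_rfl
  · by_cases hv : v ∈ S₀
    · rw [W.twistedSelmerStructureOfLocal_inr_of_mem p S₀ κ J u hu L' hv]
      exact le_top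
    · by_cases hpv : ((p : ℕ) : 𝓞 K) ∈ v.asIdeal
      · rw [W.twistedSelmerStructureOfLocal_inr_of_mem_asIdeal p S₀ κ J u hu L hv hpv,
          W.twistedSelmerStructureOfLocal_inr_of_mem_asIdeal p S₀ κ J u hu L' hv hpv]
        exact h v
      · rw [W.twistedSelmerStructureOfLocal_inr_of_not_mem p S₀ κ J u hu L hv hpv,
          W.twistedSelmerStructureOfLocal_inr_of_not_mem p S₀ κ J u hu L' hv hpv]

/-- **`𝓕^{ker} = 𝓕`**: with the Kummer kernels as the family of conditions at `p`, `𝓕^L` is the sibling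
`twistedKummerSelmerStructure` BY NAME. [cite: GreenbergLNM1716, §4 pp. 122–124] -/
theorem twistedSelmerStructureOfLocal_ker :
    W.twistedSelmerStructureOfLocal p S₀ κ J u hu
        (fun v ↦ (W.twistedTorsionToLocalH1 p κ J u hu (v.adicCompletion K)).ker) =
      W.twistedKummerSelmerStructure p S₀ κ J u hu := by
  funext v
  rcases v with w | v
  · rfl
  · by_cases hv : v ∈ S₀
    · rw [W.twistedSelmerStructureOfLocal_inr_of_mem p S₀ κ J u hu _ hv,
        W.twistedKummerSelmerStructure_inr_of_mem p S₀ κ J u hu hv]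
    · by_cases hpv : ((p : ℕ) : 𝓞 K) ∈ v.asIdeal
      · rw [W.twistedSelmerStructureOfLocal_inr_of_mem_asIdeal p S₀ κ J u hu _ hv hpv,
          W.twistedKummerSelmerStructure_inr_of_mem_asIdeal p S₀ κ J u hu hv hpv]
      · rw [W.twistedSelmerStructureOfLocal_inr_of_not_mem p S₀ κ J u hu _ hv hpv,
          W.twistedKummerSelmerStructure_inr_of_not_mem p S₀ κ J u hu hv hpv]

/-- **`𝓕^L ≤ 𝓕` as soon as every `L_v` lies in the Kummer kernel.** [cite: GreenbergLNM1716, §4 p. 123] -/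
theorem twistedSelmerStructureOfLocal_le_kummer
    (hL : ∀ v, L v ≤ (W.twistedTorsionToLocalH1 p κ J u hu (v.adicCompletion K)).ker) :
    W.twistedSelmerStructureOfLocal p S₀ κ J u hu L ≤ W.twistedKummerSelmerStructure p S₀ κ J u hu := by
  rw [← W.twistedSelmerStructureOfLocal_ker p S₀ κ J u hu]
  exact W.twistedSelmerStructureOfLocal_mono p S₀ κ J u hu hL

/-- **`𝓕^L ≤ 𝓖`** (`𝓖 = twistedRelaxedSelmerStructure`: everything at `∞`, `S₀`, `p`). [cite: GreenbergLNM1716, §4 p. 124] -/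
theorem twistedSelmerStructureOfLocal_le_relaxed :
    W.twistedSelmerStructureOfLocal p S₀ κ J u hu L ≤ W.twistedRelaxedSelmerStructure p S₀ κ J u hu := by
  intro v
  rcases v with w | v
  · rw [twistedRelaxedSelmerStructure_inl]
    exact le_top
  · by_cases hv : v ∈ S₀
    · rw [W.twistedRelaxedSelmerStructure_inr_of_mem p S₀ κ J u hu hv]
      exact le_top
    · by_cases hpv : ((p : ℕ) : 𝓞 K) ∈ v.asIdeal
      · rw [W.twistedRelaxedSelmerStructure_inr_of_mem_asIdeal p S₀ κ J u hu hpv]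
        exact le_top
      · rw [W.twistedSelmerStructureOfLocal_inr_of_not_mem p S₀ κ J u hu L hv hpv,
          W.twistedRelaxedSelmerStructure_inr_of_not_mem p S₀ κ J u hu hv hpv]

/-- `𝓕^L` is a Selmer structure with `Σ(𝓕^L) ⊆ S = {∞} ∪ S₀ ∪ {v ∣ p}` (`twistedDescentPlaces`).
[cite: Howard2004HeegnerKolyvagin, Def. 2.1.10] -/
theorem isUnramifiedOutside_twistedSelmerStructureOfLocal :
    (W.twistedSelmerStructureOfLocal p S₀ κ J u hu L).IsUnramifiedOutside
      (twistedDescentPlaces (K := K) p S₀) := by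
  refine ⟨inl_mem_twistedDescentPlaces p S₀, fun v hv ↦ ?_⟩
  rw [not_mem_twistedDescentPlaces_iff] at hv
  exact W.twistedSelmerStructureOfLocal_inr_of_not_mem p S₀ κ J u hu L hv.1 hv.2

/-! ### What membership in `H¹_{𝓕^L}` says, place by place -/

/-- A class of `H¹_{𝓕^L}(K, M_J)` satisfies `L_v` at every `v ∋ p` outside `S₀` (level-`K` localisation
`galoisCohomology.res … (v.adicCompletion K)`, definitionally the localisation at `Sum.inr v`).
[cite: GreenbergLNM1716, §4 p. 123] -/
theorem res_mem_of_mem_selmerGroup_ofLocal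
    {x : galoisCohomology (W.twistedTorsionGaloisModule p κ J u hu) 1}
    (hx : x ∈ (W.twistedSelmerStructureOfLocal p S₀ κ J u hu L).selmerGroup)
    {v : HeightOneSpectrum (𝓞 K)} (hv : v ∉ S₀) (hpv : ((p : ℕ) : 𝓞 K) ∈ v.asIdeal) :
    galoisCohomology.res (W.twistedTorsionGaloisModule p κ J u hu) (v.adicCompletion K) 1 x ∈ L v := by
  rw [SelmerStructure.mem_selmerGroup_iff] at hx
  have h := hx (Sum.inr v)
  rw [W.twistedSelmerStructureOfLocal_inr_of_mem_asIdeal p S₀ κ J u hu L hv hpv] at h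
  exact h

/-- A class of `H¹_{𝓕^L}(K, M_J)` is unramified at every finite `v ∉ S₀` prime to `p`.
[cite: GreenbergLNM1716, §4 p. 124] -/
theorem res_mem_unramifiedSubgroup_of_mem_selmerGroup_ofLocal
    {x : galoisCohomology (W.twistedTorsionGaloisModule p κ J u hu) 1}
    (hx : x ∈ (W.twistedSelmerStructureOfLocal p S₀ κ J u hu L).selmerGroup)
    {v : HeightOneSpectrum (𝓞 K)} (hv : v ∉ S₀) (hpv : ((p : ℕ) : 𝓞 K) ∉ v.asIdeal) :
    galoisCohomology.res (W.twistedTorsionGaloisModule p κ J u hu) (v.adicCompletion K) 1 x ∈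
      unramifiedSubgroup ((W.twistedTorsionGaloisModule p κ J u hu).restrictField (v.adicCompletion K)) 1 := by
  rw [SelmerStructure.mem_selmerGroup_iff] at hx
  have h := hx (Sum.inr v)
  rw [W.twistedSelmerStructureOfLocal_inr_of_not_mem p S₀ κ J u hu L hv hpv] at h
  exact h

/-- A class of `H¹_{𝓕^L}(K, M_J)` is Kummer at every infinite place: its local class dies in `H¹((K_∞)_w, E)`.
[cite: GreenbergLNM1716, §4 p. 123] -/
theorem twistedTorsionToLocalH1_res_eq_zero_of_mem_selmerGroup_ofLocal
    {x : galoisCohomology (W.twistedTorsionGaloisModule p κ J u hu) 1}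
    (hx : x ∈ (W.twistedSelmerStructureOfLocal p S₀ κ J u hu L).selmerGroup) (w : InfinitePlace K) :
    W.twistedTorsionToLocalH1 p κ J u hu w.Completion
      (galoisCohomology.res (W.twistedTorsionGaloisModule p κ J u hu) w.Completion 1 x) = 0 := by
  rw [SelmerStructure.mem_selmerGroup_iff] at hx
  exact hx (Sum.inl w)

/-! ### The STRICT structure: locally trivial at the places above `p` -/

/-- **The strict twisted structure `𝓕^0`**: the zero condition at every `v ∋ p` outside `S₀` (Greenberg's strict
Selmer group, `L_v = 0` at `v ∣ p`), otherwise as `𝓕`. [cite: GreenbergLNM1716, §4 p. 123] -/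
def twistedStrictSelmerStructure : SelmerStructure (W.twistedTorsionGaloisModule p κ J u hu) :=
  W.twistedSelmerStructureOfLocal p S₀ κ J u hu fun _ ↦ ⊥

/-- `𝓕^0` at `v ∋ p`, `v ∉ S₀`: the zero condition. [cite: GreenbergLNM1716, §4 p. 123] -/
theorem twistedStrictSelmerStructure_inr_of_mem_asIdeal {v : HeightOneSpectrum (𝓞 K)} (hv : v ∉ S₀)
    (hpv : ((p : ℕ) : 𝓞 K) ∈ v.asIdeal) :
    W.twistedStrictSelmerStructure p S₀ κ J u hu (Sum.inr v) = ⊥ :=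
  W.twistedSelmerStructureOfLocal_inr_of_mem_asIdeal p S₀ κ J u hu _ hv hpv

/-- **`𝓕^0 ≤ 𝓕^L` for every family `L`** (the strict structure is the smallest). [cite: GreenbergLNM1716, §4 p. 123] -/
theorem twistedStrictSelmerStructure_le_ofLocal :
    W.twistedStrictSelmerStructure p S₀ κ J u hu ≤ W.twistedSelmerStructureOfLocal p S₀ κ J u hu L :=
  W.twistedSelmerStructureOfLocal_mono p S₀ κ J u hu fun _ ↦ bot_le

/-- At `v ∋ p` outside `S₀`, a class of `H¹_{𝓕^0}` has local class `0`. [cite: GreenbergLNM1716, §4 p. 123] -/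
theorem res_eq_zero_of_mem_selmerGroup_strict
    {x : galoisCohomology (W.twistedTorsionGaloisModule p κ J u hu) 1}
    (hx : x ∈ (W.twistedStrictSelmerStructure p S₀ κ J u hu).selmerGroup)
    {v : HeightOneSpectrum (𝓞 K)} (hv : v ∉ S₀) (hpv : ((p : ℕ) : 𝓞 K) ∈ v.asIdeal) :
    galoisCohomology.res (W.twistedTorsionGaloisModule p κ J u hu) (v.adicCompletion K) 1 x = 0 :=
  (AddSubgroup.mem_bot).mp (W.res_mem_of_mem_selmerGroup_ofLocal p S₀ κ J u hu _ hx hv hpv)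

/-! ### The ♯/♭ structure: Sprung's condition at ONE distinguished place above `p` -/

variable (v : HeightOneSpectrum (𝓞 K)) (M : AddSubgroup (localPoints W (v.adicCompletion K)))
  (𝒦 : Set (M →+ ℤ_[p]))

/-- **The ♯/♭ family of local conditions**: the Kummer kernels at the places above `p`, UPDATED at the distinguished
place `v` by Sprung's annihilator condition `twistedSharpFlatLocalKummer … (v.adicCompletion K) M 𝒦`
(`Function.update`; Sprung's `Sel^•` singles out ONE place of `K_∞` above `p` — intended `K = ℚ`;
TODO(general form): a family `(M_v, 𝒦_v)` over all places above `p`). [cite: Sprung2012, Def. 7.11 (p. 1503)] -/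
def twistedSharpFlatLocalFamily : ∀ v' : HeightOneSpectrum (𝓞 K),
    AddSubgroup (galoisCohomology ((W.twistedTorsionGaloisModule p κ J u hu).restrictField (v'.adicCompletion K)) 1) :=
  Function.update (fun v' ↦ (W.twistedTorsionToLocalH1 p κ J u hu (v'.adicCompletion K)).ker) v
    (W.twistedSharpFlatLocalKummer p κ J u hu (v.adicCompletion K) M 𝒦)

/-- The ♯/♭ family at the distinguished place: Sprung's condition. [cite: Sprung2012, Def. 7.11 (p. 1503) (unfolding)] -/
@[simp] theorem twistedSharpFlatLocalFamily_self :
    W.twistedSharpFlatLocalFamily p κ J u hu v M 𝒦 v =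
      W.twistedSharpFlatLocalKummer p κ J u hu (v.adicCompletion K) M 𝒦 :=
  Function.update_self _ _ _

/-- The ♯/♭ family at any other place: the Kummer kernel. [cite: Sprung2012, Def. 7.11 (p. 1503) (unfolding)] -/
theorem twistedSharpFlatLocalFamily_of_ne {v' : HeightOneSpectrum (𝓞 K)} (h : v' ≠ v) :
    W.twistedSharpFlatLocalFamily p κ J u hu v M 𝒦 v' =
      (W.twistedTorsionToLocalH1 p κ J u hu (v'.adicCompletion K)).ker :=
  Function.update_of_ne h _ _

/-- Every member of the ♯/♭ family lies in the Kummer kernel. [cite: Sprung2012, Def. 7.11 (p. 1503)] -/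
theorem twistedSharpFlatLocalFamily_le_ker (v' : HeightOneSpectrum (𝓞 K)) :
    W.twistedSharpFlatLocalFamily p κ J u hu v M 𝒦 v' ≤
      (W.twistedTorsionToLocalH1 p κ J u hu (v'.adicCompletion K)).ker := by
  by_cases h : v' = v
  · subst h
    rw [twistedSharpFlatLocalFamily_self]
    exact twistedSharpFlatLocalKummer_le_ker M 𝒦
  · rw [W.twistedSharpFlatLocalFamily_of_ne p κ J u hu v M 𝒦 h]

/-- **The ♯/♭-twisted Selmer structure `𝓕^•` on `E[p^J](χ_u)`** (the level-`K` structure whose Selmer group maps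
into Sprung's `Sel^•(E/K_∞)`, Def. 7.11): `𝓕^{L♭}` for the ♯/♭ family — i.e. the twisted Kummer structure
`twistedKummerSelmerStructure` EXCEPT at the distinguished place `v ∋ p`, where the condition is Sprung's
`E^• = Ann(𝒦)` for `(M, 𝒦)` (meant: `M = E((K_∞)_w)`, `𝒦 = Ker Col^•`). [cite: Sprung2012, Def. 7.9 and Def. 7.11 (p. 1503)]
[cite: GreenbergLNM1716, §4 pp. 122–124] -/
def twistedSharpFlatSelmerStructure : SelmerStructure (W.twistedTorsionGaloisModule p κ J u hu) :=
  W.twistedSelmerStructureOfLocal p S₀ κ J u hu (W.twistedSharpFlatLocalFamily p κ J u hu v M 𝒦)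

/-- `𝓕^•` at the distinguished place `v ∋ p` (`v ∉ S₀`): Sprung's condition.
[cite: Sprung2012, Def. 7.11 (p. 1503) (unfolding)] -/
theorem twistedSharpFlatSelmerStructure_inr_self (hv : v ∉ S₀) (hpv : ((p : ℕ) : 𝓞 K) ∈ v.asIdeal) :
    W.twistedSharpFlatSelmerStructure p S₀ κ J u hu v M 𝒦 (Sum.inr v) =
      W.twistedSharpFlatLocalKummer p κ J u hu (v.adicCompletion K) M 𝒦 := by
  rw [twistedSharpFlatSelmerStructure, W.twistedSelmerStructureOfLocal_inr_of_mem_asIdeal p S₀ κ J u hu _ hv hpv,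
    twistedSharpFlatLocalFamily_self]

/-- `𝓕^•` at another place `v' ∋ p` (`v' ∉ S₀`, `v' ≠ v`): the Kummer kernel.
[cite: Sprung2012, Def. 7.11 (p. 1503) (unfolding)] -/
theorem twistedSharpFlatSelmerStructure_inr_of_ne {v' : HeightOneSpectrum (𝓞 K)} (h : v' ≠ v) (hv' : v' ∉ S₀)
    (hpv' : ((p : ℕ) : 𝓞 K) ∈ v'.asIdeal) :
    W.twistedSharpFlatSelmerStructure p S₀ κ J u hu v M 𝒦 (Sum.inr v') =
      (W.twistedTorsionToLocalH1 p κ J u hu (v'.adicCompletion K)).ker := by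
  rw [twistedSharpFlatSelmerStructure, W.twistedSelmerStructureOfLocal_inr_of_mem_asIdeal p S₀ κ J u hu _ hv' hpv',
    W.twistedSharpFlatLocalFamily_of_ne p κ J u hu v M 𝒦 h]

/-- **`𝓕^0 ≤ 𝓕^•`** (strict ≤ ♭). [cite: GreenbergLNM1716, §4 p. 123] -/
theorem twistedStrictSelmerStructure_le_sharpFlat :
    W.twistedStrictSelmerStructure p S₀ κ J u hu ≤ W.twistedSharpFlatSelmerStructure p S₀ κ J u hu v M 𝒦 :=
  W.twistedStrictSelmerStructure_le_ofLocal p S₀ κ J u hu _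

/-- **`𝓕^• ≤ 𝓕`** (♭ ≤ Kummer: Sprung's `Sel^• ⊆ Sel`). [cite: Sprung2012, Def. 7.11 (p. 1503)] -/
theorem twistedSharpFlatSelmerStructure_le_kummer :
    W.twistedSharpFlatSelmerStructure p S₀ κ J u hu v M 𝒦 ≤ W.twistedKummerSelmerStructure p S₀ κ J u hu :=
  W.twistedSelmerStructureOfLocal_le_kummer p S₀ κ J u hu _ (W.twistedSharpFlatLocalFamily_le_ker p κ J u hu v M 𝒦)

/-- **`𝓕^• ≤ 𝓖`** (♭ ≤ relaxed, `twistedRelaxedSelmerStructure` BY NAME). [cite: GreenbergLNM1716, §4 p. 124] -/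
theorem twistedSharpFlatSelmerStructure_le_relaxed :
    W.twistedSharpFlatSelmerStructure p S₀ κ J u hu v M 𝒦 ≤ W.twistedRelaxedSelmerStructure p S₀ κ J u hu :=
  W.twistedSelmerStructureOfLocal_le_relaxed p S₀ κ J u hu _

/-- **`𝓕^0 ≤ 𝓖`** (strict ≤ relaxed). [cite: GreenbergLNM1716, §4 pp. 123–124] -/
theorem twistedStrictSelmerStructure_le_relaxed :
    W.twistedStrictSelmerStructure p S₀ κ J u hu ≤ W.twistedRelaxedSelmerStructure p S₀ κ J u hu :=
  W.twistedSelmerStructureOfLocal_le_relaxed p S₀ κ J u hu _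

/-- `𝓕^•` is a Selmer structure with `Σ(𝓕^•) ⊆ S`. [cite: Howard2004HeegnerKolyvagin, Def. 2.1.10] -/
theorem isUnramifiedOutside_twistedSharpFlatSelmerStructure :
    (W.twistedSharpFlatSelmerStructure p S₀ κ J u hu v M 𝒦).IsUnramifiedOutside
      (twistedDescentPlaces (K := K) p S₀) :=
  W.isUnramifiedOutside_twistedSelmerStructureOfLocal p S₀ κ J u hu _

/-- `𝓕^0` is a Selmer structure with `Σ(𝓕^0) ⊆ S`. [cite: Howard2004HeegnerKolyvagin, Def. 2.1.10] -/
theorem isUnramifiedOutside_twistedStrictSelmerStructure :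
    (W.twistedStrictSelmerStructure p S₀ κ J u hu).IsUnramifiedOutside (twistedDescentPlaces (K := K) p S₀) :=
  W.isUnramifiedOutside_twistedSelmerStructureOfLocal p S₀ κ J u hu _

/-- The Selmer groups follow the structures: `H¹_{𝓕^0} ≤ H¹_{𝓕^•} ≤ H¹_𝓕 ≤ H¹_𝓖` (first inclusion).
[cite: GreenbergLNM1716, §4 p. 123] -/
theorem selmerGroup_strict_le_sharpFlat :
    (W.twistedStrictSelmerStructure p S₀ κ J u hu).selmerGroup ≤
      (W.twistedSharpFlatSelmerStructure p S₀ κ J u hu v M 𝒦).selmerGroup := fun x hx ↦ by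
  rw [SelmerStructure.mem_selmerGroup_iff] at hx ⊢
  exact fun w ↦ W.twistedStrictSelmerStructure_le_sharpFlat p S₀ κ J u hu v M 𝒦 w (hx w)

/-- Second inclusion: `H¹_{𝓕^•} ≤ H¹_𝓕`. [cite: Sprung2012, Def. 7.11 (p. 1503)] -/
theorem selmerGroup_sharpFlat_le_kummer :
    (W.twistedSharpFlatSelmerStructure p S₀ κ J u hu v M 𝒦).selmerGroup ≤
      (W.twistedKummerSelmerStructure p S₀ κ J u hu).selmerGroup := fun x hx ↦ by
  rw [SelmerStructure.mem_selmerGroup_iff] at hx ⊢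
  exact fun w ↦ W.twistedSharpFlatSelmerStructure_le_kummer p S₀ κ J u hu v M 𝒦 w (hx w)

/-- Third inclusion: `H¹_{𝓕^•} ≤ H¹_𝓖`. [cite: GreenbergLNM1716, §4 p. 124] -/
theorem selmerGroup_sharpFlat_le_relaxed :
    (W.twistedSharpFlatSelmerStructure p S₀ κ J u hu v M 𝒦).selmerGroup ≤
      (W.twistedRelaxedSelmerStructure p S₀ κ J u hu).selmerGroup := fun x hx ↦ by
  rw [SelmerStructure.mem_selmerGroup_iff] at hx ⊢
  exact fun w ↦ W.twistedSharpFlatSelmerStructure_le_relaxed p S₀ κ J u hu v M 𝒦 w (hx w)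

/-- **What membership in `H¹_{𝓕^•}` says at the distinguished place**: the localisation at `v` satisfies Sprung's
condition. [cite: Sprung2012, Def. 7.11 (p. 1503)] -/
theorem res_mem_twistedSharpFlatLocalKummer_of_mem_selmerGroup
    {x : galoisCohomology (W.twistedTorsionGaloisModule p κ J u hu) 1}
    (hx : x ∈ (W.twistedSharpFlatSelmerStructure p S₀ κ J u hu v M 𝒦).selmerGroup)
    (hv : v ∉ S₀) (hpv : ((p : ℕ) : 𝓞 K) ∈ v.asIdeal) :
    galoisCohomology.res (W.twistedTorsionGaloisModule p κ J u hu) (v.adicCompletion K) 1 x ∈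
      W.twistedSharpFlatLocalKummer p κ J u hu (v.adicCompletion K) M 𝒦 := by
  have h := W.res_mem_of_mem_selmerGroup_ofLocal p S₀ κ J u hu _ hx hv hpv
  rwa [twistedSharpFlatLocalFamily_self] at h

end Structures

end WeierstrassCurve

end
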